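import Summits.NavierStokesRegularity.NavierStokesRegularity.Theses.GaldiLiouvilleGate

/-!
# GaldiLiouvilleGateCylinderBudgetsDefs — DEFS OF RECORD for census rows S1 ⟨0895⟩ `GaldiLiouville` (line «allaxes»,
# ns-idea-4 g8-2) and S3 ⟨0896⟩ `AxisymGaldiLiouville` (line «cylbudget», g8-1)

= the `def`s of the cell's COMBINED DEFS FILE v3.1 `pub/ideators/ns-idea-4/lines/combined/CylinderBudgets_v3_1.lean`
(sha16 817120c4c833a18a; critic idea-crit-3 kernel-confirmed 11:08:12Z; DIRECTOR-NS #210 (4) «Defs file of record»), §1 and §2,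
BYTE-VERBATIM bodies; the only change is the namespace prefix `…Cruxes.` ↦ `…Theorems.` so that the texts live next to the
landed pieces (`…Theorems.GaldiLiouville.AllAxesBudget.*`: ser-a g2 p628250/p629261/p629668, s29-p2 g3 p628574/p629569;
`…Theorems.AxisymGaldiLiouville.CylinderBudget.*`: C26-p1 g4 p626391/p626924).  Filed by the lane's RUNG/DEFS ASSEMBLER
ns-s29-p2 g3 on the arbiter's ruling (ns-in-ser-a g2, 11:45:36Z (2)); the ASSEMBLY file
`Theorems/GaldiLiouvilleGateCylinderBudgetsAssembly.lean` plugs every landed piece into these Props by `exact` and proves the RUNG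
`hoopEnergyLiouville_of` / `finiteSwirlEnergyLiouville_of` compositions BY NAME.  No theorem of substance here: Props and
functionals only (every obligation of the two lines is a `def … : Prop`; the stubs and compositions of v3.1 are NOT copied).

§1 (⟨0895⟩, NO symmetry): `IsDSolution` (the five hypotheses of `GaldiLiouville` bundled), `swirlRateSq`, `swirlTail`,
`axialEnergyIn`, O1 `CylinderBudget`, O1a `PressureHessianIntegrable`, O1b `HeadMaximumPrinciple`, O1c `CylinderBookkeeping`,
O2 `AxialRigidity`, K2 `HoopTailFinite`, K1 `HoopTailCritical`, RUNG `HoopEnergyLiouville`, O3 `SwirlEnergyTailVanish`, and the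
finer O1c split O1a′ `PressureCylinderDecay`, O1a″ `CylinderDecayOfHessian`, O1c′ `CylinderBookkeepingSplit`.
§2 (⟨0896⟩, axisymmetric specialisation): `IsAxisymDSolution`, `swirlMoment`, `CylinderBudget`, `AxialRigidity`, K2
`SwirlMomentGain`, K1 `SwirlTailCritical`, RUNG `FiniteSwirlEnergyLiouville`.

WHAT THIS IS NOT: no summit, no ⟨0895⟩/⟨0896⟩ claim, no NS-regularity statement is proved or asserted here; K1 of each line is
declared S1/S3-strength by the line card (LINE-allaxes_v1.md); the `def`s are route-posited texts (D-0016 `<Route>Defs`).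
-/

noncomputable section

open MeasureTheory Set Filter Topology
open scoped ENNReal
open Literature.Analysis.FluidPDE

set_option linter.dupNamespace false

/-! ## §1 — LINE «allaxes» (⟨0895⟩ `GaldiLiouville`, general D-solutions) -/

namespace Summit.NavierStokesRegularity.NavierStokesRegularity.Theorems.GaldiLiouville.AllAxesBudget

local notation "ℝ³" => EuclideanSpace ℝ (Fin 3)

/-- The hypotheses of `GaldiLiouville` ⟨0895⟩ on `(ν, U, P)`, bundled VERBATIM: steady profile system
(`IsLerayProfile ν 0`), smooth, finite Dirichlet integral, `U → 0` at infinity. NO symmetry. -/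
def IsDSolution (ν : ℝ) (U : ℝ³ → ℝ³) (P : ℝ³ → ℝ) : Prop :=
  IsLerayProfile ν 0 U P ∧ ContDiff ℝ (⊤ : ℕ∞) U ∧ ContDiff ℝ (⊤ : ℕ∞) P ∧
    (∫⁻ y, ENNReal.ofReal (frobeniusNormSq (fderiv ℝ U y))) < ⊤ ∧
    Tendsto U (cocompact ℝ³) (𝓝 0)

/-- `(u_θ / r)²` about the x₃-axis (`swirlVelocity U x = ⟪U x, e_θ(x)⟫`, `cylRadius x = r`; both are
defined for every field, junk `0` on the axis) as an extended nonnegative real. -/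
def swirlRateSq (U : ℝ³ → ℝ³) (x : ℝ³) : ℝ≥0∞ :=
  ENNReal.ofReal ((swirlVelocity U x / cylRadius x) ^ 2)

/-- Outer hoop tail `T_U(t) = ∫_{r > t} (u_θ/r)² dx` (= `∫_t^∞ Θ(r) dr/r`; may be `⊤` in general). -/
def swirlTail (U : ℝ³ → ℝ³) (t : ℝ) : ℝ≥0∞ :=
  ∫⁻ x in {x : ℝ³ | t < cylRadius x}, swirlRateSq U x

/-- Inner axial energy `A_U(t) = ∫_{r ≤ t} u_z² dx` (= `∫_0^t r Z(r) dr`; finite for D-solutions). -/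
def axialEnergyIn (U : ℝ³ → ℝ³) (t : ℝ) : ℝ≥0∞ :=
  ∫⁻ x in {x : ℝ³ | cylRadius x ≤ t}, ENNReal.ofReal (axialVelocity U x ^ 2)

/-- O1 (target of O1a–O1c) · ALL-AXES CYLINDER BUDGET (new identity's typed corollary): for EVERY smooth
D-solution (no symmetry) and every `t > 0`, `∫_{r ≤ t} u_z² ≤ t² ∫_{r > t} (u_θ/r)²` about the x₃-axis
(trivially true when the hoop tail is `⊤`). Derived on paper from O1a + O1b by the cylinder bookkeeping
O1c (radial test fields on coaxial cylinders; viscous flux ≡ 0; `S(∞) = 0`). Not a stub itself. -/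
def CylinderBudget : Prop :=
  ∀ ν : ℝ, 0 < ν → ∀ (U : ℝ³ → ℝ³) (P : ℝ³ → ℝ), IsDSolution ν U P → ∀ t : ℝ, 0 < t →
    axialEnergyIn U t ≤ ENNReal.ofReal (t ^ 2) * swirlTail U t

/-- support · O1a · PRESSURE HESSIAN INTEGRABLE (Literature-fact-shaped, to be CITED not proved: the
Coifman–Lions–Meyer–Semmes 1993 div–curl lemma puts `Δp = −∂ᵢuⱼ∂ⱼuᵢ` in the Hardy space `ℋ¹(ℝ³)`, and
Calderón–Zygmund is bounded on `ℋ¹`; KPR 2015 Lemma = W. Wang's monograph Lemma 3.5, stated for general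
(non-symmetric) D-solutions; X-sized as a Lean proof): `∇²p ∈ L¹(ℝ³)`. It is what makes every cylinder
functional (`∬|p|`, `∬|u|²` over `{r = t}`) finite and tend to `0` — kinematics alone does not. -/
def PressureHessianIntegrable : Prop :=
  ∀ ν : ℝ, 0 < ν → ∀ (U : ℝ³ → ℝ³) (P : ℝ³ → ℝ), IsDSolution ν U P →
    Integrable (iteratedFDeriv ℝ 2 P)

/-- support · O1b · HEAD MAXIMUM PRINCIPLE (general steady NS, any symmetry; M–L in Lean): the pressure has
a limit `p_∞` at infinity (Galdi X.5.1) and the Bernoulli head obeys `p + |u|²/2 ≤ p_∞` everywhere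
(`νΔQ − u·∇Q = ν|ω|² ≥ 0`, weak maximum principle on large balls, `Q → p_∞`). -/
def HeadMaximumPrinciple : Prop :=
  ∀ ν : ℝ, 0 < ν → ∀ (U : ℝ³ → ℝ³) (P : ℝ³ → ℝ), IsDSolution ν U P →
    ∃ c : ℝ, Tendsto P (cocompact ℝ³) (𝓝 c) ∧ ∀ x, P x + ‖U x‖ ^ 2 / 2 ≤ c

/-- support · O1c · CYLINDER BOOKKEEPING (M in Lean, done on paper; numerically certified kit j306161):
given O1a and O1b, the divergence theorem on solid cylinders `{r < t, |z| < Z}` with the radial test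
fields `e_r` and `x_h` (caps → 0 by uniform decay of `u, ω`; lateral viscous flux ≡ 0), Fubini, and
`S(∞) = 0` give the two identities `t S' = Θ − Rr`, `t² S = −∫₀ᵗ s(Z + D) ds` and hence O1. -/
def CylinderBookkeeping : Prop :=
  PressureHessianIntegrable → HeadMaximumPrinciple → CylinderBudget

/-- support · O2 · AXIAL-COMPONENT RIGIDITY (provable now): a D-solution with `u₃ ≡ 0` (a.e. on every
solid cylinder, hence everywhere) vanishes: the third equation gives `∂₃p = 0`, letting `x₃ → ∞` in
the horizontal equations (uniform decay of `u`) gives `∇ₕp = 0` in `𝒟'(ℝ²)`, so `p` is constant; then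
`|u|²/2` is a decaying subsolution (`νΔ(|u|²/2) − u·∇(|u|²/2) = ν|∇u|²`) ⇒ `u ≡ 0`. -/
def AxialRigidity : Prop :=
  ∀ ν : ℝ, 0 < ν → ∀ (U : ℝ³ → ℝ³) (P : ℝ³ → ℝ), IsDSolution ν U P →
    (∀ t : ℝ, 0 < t → axialEnergyIn U t = 0) → U = 0

/-- crux (rank 3) · K2 · HOOP TAIL FINITE (first rung; strictly partial — consistent with a
hypothetical nontrivial solution of decay `|u| ≍ |x|^{-a}`, `a > 1/2`): every D-solution has finite
`r⁻²`-weighted azimuthal energy outside the unit cylinder about the axis, `∫_{r>1} (u_θ/r)² dx < ∞`.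
Automatic under axisymmetry (`|u_θ/r| ≤ |∇u|`); for general D-solutions only the DIFFERENCE
`∫_{r>1}(u_θ² − u_r²)/r²` is known finite (by the identity) — the statement asks the first genuinely
anisotropic piece of decay information. -/
def HoopTailFinite : Prop :=
  ∀ ν : ℝ, 0 < ν → ∀ (U : ℝ³ → ℝ³) (P : ℝ³ → ℝ), IsDSolution ν U P → swirlTail U 1 < ⊤

/-- crux (rank 2, deciding) · K1 · HOOP TAIL CRITICAL (the climb; S1-strength given O1 + O2 —
declared): a D-solution with finite hoop tail about the axis has a SUBCRITICAL hoop tail along a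
sequence of coaxial cylinders, `liminf_t t² ∫_{r>t} (u_θ/r)² = 0`. By the all-axes identity a
nontrivial D-solution violates this about EVERY axis (`t² T(t) ≥ ∫_{r<t} u_z² + 2|Q| ↑`), so the
freedom of the axis (any point, any direction) is the attack surface. -/
def HoopTailCritical : Prop :=
  ∀ ν : ℝ, 0 < ν → ∀ (U : ℝ³ → ℝ³) (P : ℝ³ → ℝ), IsDSolution ν U P → swirlTail U 1 < ⊤ →
    Filter.liminf (fun t : ℝ => ENNReal.ofReal (t ^ 2) * swirlTail U t) atTop = 0

/-- RUNG (BC5 witness; new ANISOTROPIC one-component Liouville criterion, no symmetry): a D-solution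
whose azimuthal component about the x₃-axis (hence, by invariance, about any axis) is square-integrable,
`u_θ ∈ L²(ℝ³)`, vanishes. Independent of the printed anisotropic criteria (Chae 2023: every Cartesian
component in a mixed `L^{3/2} ∩ L⁶`/`L⁶` norm; Zhang–Zu 2025; arXiv:2605.05647: spherical radial
component `u_ρ ∈ L^p`, `3/2 < p ≤ 3`) and of the isotropic ones (`L^{9/2}`, `BMO⁻¹`, log-criteria).
Derived below from O1 + O2 + a measure-theoretic tail lemma (`hoopEnergyLiouville_of`, kernel-checked). -/
def HoopEnergyLiouville : Prop :=
  ∀ ν : ℝ, 0 < ν → ∀ (U : ℝ³ → ℝ³) (P : ℝ³ → ℝ), IsDSolution ν U P →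
    (∫⁻ x, ENNReal.ofReal (swirlVelocity U x ^ 2)) < ⊤ → U = 0

/-- support · O3 · pure measure theory (S): the outer-cylinder tails of the finite integral `∫ u_θ²` vanish
(dominated convergence for `u_θ² · 1_{r > t} ↓ 0`; measurability from smoothness of `U`). -/
def SwirlEnergyTailVanish : Prop :=
  ∀ (U : ℝ³ → ℝ³), ContDiff ℝ (⊤ : ℕ∞) U → (∫⁻ x, ENNReal.ofReal (swirlVelocity U x ^ 2)) < ⊤ →
    Tendsto (fun t : ℝ => ∫⁻ x in {x : ℝ³ | t < cylRadius x}, ENNReal.ofReal (swirlVelocity U x ^ 2))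
      atTop (𝓝 0)

/-- O1a′ · support · PRESSURE CYLINDER DECAY (consumable form of O1a+limit): there is `c` with `P → c` at infinity,
`∫_{r<R}|P − c| dx < ∞` for every `R`, and `R⁻²∫_{R<r<2R}|P − c| dx → 0`. [KPR 2015 Lemma; W. Wang monograph
L.3.5; CLMS 1993; Galdi 2011 Thm X.5.1 for `P → c`.] -/
def PressureCylinderDecay : Prop :=
  ∀ ν : ℝ, 0 < ν → ∀ (U : ℝ³ → ℝ³) (P : ℝ³ → ℝ), IsDSolution ν U P →
    ∃ c : ℝ, Tendsto P (cocompact ℝ³) (𝓝 c) ∧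
      (∀ R : ℝ, (∫⁻ x in {x | cylRadius x < R}, ENNReal.ofReal |P x - c|) < ⊤) ∧
      Tendsto (fun R : ℝ => ENNReal.ofReal (R⁻¹ ^ 2) *
        ∫⁻ x in {x | R < cylRadius x ∧ cylRadius x < 2 * R}, ENNReal.ofReal |P x - c|) atTop (𝓝 0)

/-- O1a″ · support (M–L) · the `(s−t)/s ≤ 1` trick: `∇²P ∈ L¹` and the head principle (for `P → c`) give the
cylinder decay. -/
def CylinderDecayOfHessian : Prop :=
  PressureHessianIntegrable → HeadMaximumPrinciple → PressureCylinderDecay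

/-- O1c′ · support (M) · ONE-STROKE BOOKKEEPING: the tested identity with `ψ = G(r)χ(z/L)` and the profile
`G′ = r ∧ t²/r`, using (i)(ii) of `PressureCylinderDecay` for the cut-offs and the head principle for the sign,
gives the budget. -/
def CylinderBookkeepingSplit : Prop :=
  PressureCylinderDecay → HeadMaximumPrinciple → CylinderBudget

end Summit.NavierStokesRegularity.NavierStokesRegularity.Theorems.GaldiLiouville.AllAxesBudget

/-! ## §2 — LINE «cylbudget» (⟨0896⟩ `AxisymGaldiLiouville`, axisymmetric specialisation) -/

namespace Summit.NavierStokesRegularity.NavierStokesRegularity.Theorems.AxisymGaldiLiouville.CylinderBudget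

open Summit.NavierStokesRegularity.NavierStokesRegularity.Theorems.GaldiLiouville
open Summit.NavierStokesRegularity.NavierStokesRegularity.Theorems.GaldiLiouville.AllAxesBudget

local notation "ℝ³" => EuclideanSpace ℝ (Fin 3)

/-- The hypotheses of `AxisymGaldiLiouville` ⟨0896⟩ on `(ν, U, P)`, bundled VERBATIM (six: the five of
⟨0895⟩ plus `IsAxisymmetric U`). -/
def IsAxisymDSolution (ν : ℝ) (U : ℝ³ → ℝ³) (P : ℝ³ → ℝ) : Prop :=
  IsLerayProfile ν 0 U P ∧ IsAxisymmetric U ∧ ContDiff ℝ (⊤ : ℕ∞) U ∧ ContDiff ℝ (⊤ : ℕ∞) P ∧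
    (∫⁻ y, ENNReal.ofReal (frobeniusNormSq (fderiv ℝ U y))) < ⊤ ∧
    Tendsto U (cocompact ℝ³) (𝓝 0)

/-- Weighted swirl moment `∫ (1 + r)^σ (u_θ/r)² dx`; `σ = 0` is finite for every axisymmetric D-solution
(`|u_θ/r| ≤ |∇u|`), `σ = 2` is `u_θ ∈ L²` up to the axis region. -/
def swirlMoment (σ : ℝ) (U : ℝ³ → ℝ³) : ℝ≥0∞ :=
  ∫⁻ x, ENNReal.ofReal ((1 + cylRadius x) ^ σ * (swirlVelocity U x / cylRadius x) ^ 2)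

/-- O1-axisym (special case of §1 `CylinderBudget`; the body nsreg-C26-p1 works against). -/
def CylinderBudget : Prop :=
  ∀ ν : ℝ, 0 < ν → ∀ (U : ℝ³ → ℝ³) (P : ℝ³ → ℝ), IsAxisymDSolution ν U P → ∀ t : ℝ, 0 < t →
    axialEnergyIn U t ≤ ENNReal.ofReal (t ^ 2) * swirlTail U t

/-- O2-axisym (special case of §1 `AxialRigidity`; landed/firing in the axisymmetric form by nsreg-C26-p1 via
`div`-free ⇒ `u_r = f(z)/r` ⇒ 0, harmonic `u_θ e_θ` ⇒ 0). -/
def AxialRigidity : Prop :=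
  ∀ ν : ℝ, 0 < ν → ∀ (U : ℝ³ → ℝ³) (P : ℝ³ → ℝ), IsAxisymDSolution ν U P →
    (∀ t : ℝ, 0 < t → axialEnergyIn U t = 0) → U = 0

/-- crux (rank 3) · K2 · SWIRL MOMENT GAIN (first rung of the swirl-moment ladder; strictly partial; per-solution
`σ`): every axisymmetric D-solution gains SOME positive power of `r` in its weighted swirl energy. No named
structure yields even a logarithm at the critical rate today. -/
def SwirlMomentGain : Prop :=
  ∀ ν : ℝ, 0 < ν → ∀ (U : ℝ³ → ℝ³) (P : ℝ³ → ℝ), IsAxisymDSolution ν U P →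
    ∃ σ : ℝ, 0 < σ ∧ swirlMoment σ U < ⊤

/-- crux (rank 2, deciding) · K1 · SWIRL TAIL CRITICAL (S3-strength given O1 + O2 — declared): an axisymmetric
D-solution whose swirl has some positive moment gain has a SUBCRITICAL swirl tail along a sequence of
cylinders: `liminf_t t² ∫_{r>t} (u_θ/r)² = 0`. -/
def SwirlTailCritical : Prop :=
  ∀ ν : ℝ, 0 < ν → ∀ (U : ℝ³ → ℝ³) (P : ℝ³ → ℝ), IsAxisymDSolution ν U P →
    (∃ σ : ℝ, 0 < σ ∧ swirlMoment σ U < ⊤) →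
    Filter.liminf (fun t : ℝ => ENNReal.ofReal (t ^ 2) * swirlTail U t) atTop = 0

/-- RUNG (axisymmetric form; implied by §1 `HoopEnergyLiouville`): an axisymmetric D-solution with `u_θ ∈ L²(ℝ³)`
vanishes. -/
def FiniteSwirlEnergyLiouville : Prop :=
  ∀ ν : ℝ, 0 < ν → ∀ (U : ℝ³ → ℝ³) (P : ℝ³ → ℝ), IsAxisymDSolution ν U P →
    (∫⁻ x, ENNReal.ofReal (swirlVelocity U x ^ 2)) < ⊤ → U = 0

end Summit.NavierStokesRegularity.NavierStokesRegularity.Theorems.AxisymGaldiLiouville.CylinderBudget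

end
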